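import Summits.QuantumFields.YangMills.Theorems.BalabanUVNodesN15CurvedGluingCubeSmoothCutDressedRemainderDefect
import Summits.QuantumFields.YangMills.Theorems.BalabanUVNodesN15CurvedGluingSmoothCutDressedGlued
import HarnessLib

/-!
# Route «BalabanUVNodes» (cluster K4 «SpineRates»), Track-A DAG node N15 = NE2, BACKGROUND LAYER — THE TWO-GRID η-DEFECT OF THE GLUED LIVE-BACKGROUND PROPAGATOR FROM DRESSED SMOOTH-CUT
# CUBES: file 32's two-grid gluing-with-defects run on the FAMILIES `X_□, X′_□` at both lattice spacings, every per-cube row and defect supplied BY NAME (files 34∕35 cut letters∕defect, 38∕39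
# remainder rows∕defect, 33 tails∕defect) — `𝔇(𝒢′, 𝒢) ≤ C·e^{−(ρ₃−2σ)d}` with `C` file 32's constant at the lineage's letters (the companion of file 44's one-grid decay + inverse)

Cell `pub-ymgap`, seat `pub-ymgap-dag-n15-w3` (WIDTH SEAT 3∕3 on node N15, director-ym №197 ∕ HUMAN RULING D-0149; plan `W-SEAT-START-LIST.md` §n15 item 3 «LG-vector + background layers at
GENERAL small-field U» — forty-fifth piece).  `bears_on: R4∕N15 · K3⁸ SpineGivenEndpointR13SepCoPHV (stmt-QuantumFields-27366; K3⁷ 20544 aside — KEY MAP v2)`.  Filed `--kind proof --supports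
stmt-QuantumFields-27366 --as helper` — COUNT-NEUTRAL.  Theorems only; 0 `sorry`.  Imports BY NAME file 39 `…SmoothCutDressedRemainderDefect` (through it 35∕34∕31 and dag-n15-w4's rows) and
file 44 `…SmoothCutDressedGlued` (through it 38, 33 `…CubeDressedTail`, 32 `…CubeDefectGluing`; `weight_mul_exp_rate_mono`); nothing in the tree is modified.

WHAT.  As in file 44 at both grids (cubes `k : K` paired across `π`: `N_k, N′_k`, cuts `χ_k, χ′_k`, bumps, input cuts, ONE reach `S_k`, partitions `h_k, h′_k` with a common block reading `hb_k`),
the perturbations `V̂, V̂′` (letter `R`, fit `o`), local parts `W, W′`, flat nonlocal summands `N_L, N_L′`; `𝒢, 𝒢′` the glued operators with defects.  ★★★ `hasMaj_idef_glueInv_smoothCutDressed`: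
file 32 `hasMaj_idef_glued_of_cutRows_defect` fed by file 34 (`hGc, hGc′` via `mulOp_comp_smoothCutDressed`), file 35 ★★★ `hasMaj_idef_smoothCutDressed_loc₂` (`hDGc`), file 38 (`hK, hK′`),
file 39 ★★★ `hasMaj_idef_commOp_cubeOp_smoothCutDressed_in` (`hDK`), file 33 (`hE, hE′` and ★★ `hasMaj_idef_dressedTail_out` = `hDE`, with the pair letters of files 23∕24 BY NAME), every
row weakened to the common rate `ρ₃`; constants: `β̄′ = β̄(1 − β̄Rc_r²)⁻¹`, `θ₀` (file 38), `ε̄ = ε₀(1 − β̄Rc_r²)⁻¹`, `m = A_D(β̄, m̄)`, `r = r₀` (file 39), `r_E` (file 33), partition fit `oo`.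
What stays DISPLAYED: exactly file 44's list at both grids plus the two-grid defects of the cut rows (`m₀, m₁`), of the tail rows (`r_F`), of the `W`-rows (`r_W`), of `[N_L, M_h]` (`r_N`), of
`V̂` (`o`), the bumps' and partitions' fits — all located (dag-n15-a's images geometry ∕ dag-n15-c's FILES 67–71 ∕ the species' `EtaRateIneq342` faces).

HONEST FRAMING ∕ LIMITS.  Composition of LANDED theorems over DISPLAYED rows — the operator-level content of NE2's two-grid comparison as a CONDITIONAL statement on model carriers; nothing
of [B5]∕[B6]∕[B9] asserted ((2.133)–(2.136) p.247, (3.62)–(3.65) pp.402–403, Thm 3.14 pp.426–427 = SHAPES ∕ MECHANISM ∕ TEMPLATE); at a genuine non-abelian `U` every row is MODEL-LEVEL until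
the transporter letters inhabit `V̂`.  NE2⁺ NOT PRINTED, NOT proved; N15 NOT discharged; counts of record UNMOVED (typed 28∕28 · discharged 5∕27); one finite 𝕋⁴ at fixed ε — NOT infinite
volume, NOT OS on ℝ⁴, NOT a mass gap, NOT Clay; R4 closes the conditional finite-𝕋⁴ rung `BalabanLadder.UV` only.
-/

set_option autoImplicit false

noncomputable section
open scoped BigOperators
open Finset

namespace Summit.QuantumFields.YangMills.BalabanUVNodes.N15.CurvedSpecies

open Literature.MathematicalPhysics.QuantumFieldTheory.Balaban1983to89
open Literature.MathematicalPhysics.QuantumFieldTheory.Balaban1983to89.B11SectG (BlockNorm HasMaj RowSum)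
open Literature.MathematicalPhysics.QuantumFieldTheory.Balaban1983to89.B6RandomWalk (Triangle254)
open Literature.MathematicalPhysics.QuantumFieldTheory.Balaban1983to89.T4EtaRateDefect (idef)
open Literature.MathematicalPhysics.QuantumFieldTheory.Balaban1983to89.T4EtaRateCoeffDefect (pull)
open Literature.MathematicalPhysics.QuantumFieldTheory.Balaban1983to89.B6Prop26Gluing (mulOp mulOp_apply ind ind_nonneg ind_le_one)
open Summit.QuantumFields.YangMills.BalabanUVNodes.N15.MatrixSpecies (liftBlk liftMap liftEquiv liftEquiv_apply liftEquiv_symm_apply)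
open Summit.QuantumFields.YangMills.BalabanUVNodes.N15.BackgroundLayer (fgrad bgrad fgradAdj stack projO blkPair liftPair bgPropV)
open Summit.QuantumFields.YangMills.BalabanUVNodes.N15.Gluing (commOp lapOp parametrix remainder glueInv)

variable {X X' ι J K : Type} [Fintype X] [Fintype X'] [DecidableEq X] [DecidableEq X'] [Fintype ι] [DecidableEq ι] [Fintype J] [DecidableEq J] [Fintype K] {g : B6.Geometry}
  (blk : X → g.Site) (π : X' → X) (τ : J → X ≃ X) (τ' : J → X' ≃ X') (n n' : ℝ) {σ cr : ℝ}
  {N : K → (X × ι → ℝ) →ₗ[ℝ] (X × ι → ℝ)} {N' : K → (X' × ι → ℝ) →ₗ[ℝ] (X' × ι → ℝ)} {V : ((X × ι) × Option (J ⊕ J) → ℝ) →ₗ[ℝ] (X × ι → ℝ)}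
  {V' : ((X' × ι) × Option (J ⊕ J) → ℝ) →ₗ[ℝ] (X' × ι → ℝ)} {W NL : (X × ι → ℝ) →ₗ[ℝ] (X × ι → ℝ)} {W' NL' : (X' × ι → ℝ) →ₗ[ℝ] (X' × ι → ℝ)}
  {χX χtX ψX : K → X → ℝ} {χX' χtX' ψX' : K → X' → ℝ} {Sk : K → Set g.Site} {h : K → X × ι → ℝ} {h' : K → X' × ι → ℝ} {hb : K → g.Site → ℝ}
  {β β₁ ct m₀ m₁ oχ oχ₁ oχ₂ δ : ℝ}

omit [Fintype X] [Fintype X'] [DecidableEq X] [DecidableEq X'] [Fintype ι] [DecidableEq ι] [DecidableEq J] [Fintype K] in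
/-- The letters of ★★★ below are nonnegative (I): `β̄`, `m̄`, `β̄′ = β̄(1 − β̄Rc_r²)⁻¹`, `A_D`, `θ₀` (file 38), `ε̄`, `r_E` (file 33) — proved apart so that the main composition runs in the
default heartbeat budget. [folklore] -/
theorem gluedDefect_letters_nonneg {R o c₁ c₂ θW cN ℓ ω d₁ ε₀ rF ε : ℝ} (hβ : 0 ≤ β) (hβ₁ : 0 ≤ β₁) (hct : 0 ≤ ct) (hm₀ : 0 ≤ m₀) (hm₁ : 0 ≤ m₁) (hoχ : 0 ≤ oχ)
    (hoχ₁ : 0 ≤ oχ₁) (hoχ₂ : 0 ≤ oχ₂) (hR : 0 ≤ R) (ho : 0 ≤ o) (hε : 0 < ε) (hc₁ : 0 ≤ c₁) (hc₂ : 0 ≤ c₂) (hθW : 0 ≤ θW) (hcN : 0 ≤ cN) (hℓ : 0 ≤ ℓ) (hω : 0 ≤ ω)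
    (hd₁ : 0 ≤ d₁) (hε₀ : 0 ≤ ε₀) (hrF : 0 ≤ rF) (hcr : 0 ≤ cr) (hq : (β + (β₁ + ct * β)) * (R * cr) * cr < 1) :
    0 ≤ (β + (β₁ + ct * β)) ∧ 0 ≤ ((m₀ + oχ * β) + (m₁ + oχ₁ * β₁ + ct * m₀ + oχ₂ * β)) ∧ 0 ≤ ((β + (β₁ + ct * β)) * (1 - (β + (β₁ + ct * β)) * (R * cr) * cr)⁻¹) ∧
    0 ≤ ((((m₀ + oχ * β) + (m₁ + oχ₁ * β₁ + ct * m₀ + oχ₂ * β)) * cr + 1 * (((m₀ + oχ * β) + (m₁ + oχ₁ * β₁ + ct * m₀ + oχ₂ * β)) * cr) * (R * ((β + (β₁ + ct * β)) * (1 - (β + (β₁ + ct * β)) * (R * cr) * cr)⁻¹) * cr) + (β + (β₁ + ct * β)) * o * cr * ((β + (β₁ + ct * β)) * (1 - (β + (β₁ + ct * β)) * (R * cr) * cr)⁻¹) * cr) * (1 - 1 * ((β + (β₁ + ct * β)) * (R * cr) * cr))⁻¹) ∧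
    0 ≤ (((Fintype.card J : ℝ) * (c₂ * ((β + (β₁ + ct * β)) * (1 - (β + (β₁ + ct * β)) * (R * cr) * cr)⁻¹) + 2 * (c₁ * ((β + (β₁ + ct * β)) * (1 - (β + (β₁ + ct * β)) * (R * cr) * cr)⁻¹))) + θW + cN * ((β + (β₁ + ct * β)) * (1 - (β + (β₁ + ct * β)) * (R * cr) * cr)⁻¹) * cr)
          + ((ℓ * (Real.exp 1 * ε)⁻¹ + 2 * (ω + ℓ * d₁)) * R * ((β + (β₁ + ct * β)) * (1 - (β + (β₁ + ct * β)) * (R * cr) * cr)⁻¹) * cr + R * c₁ * ((β + (β₁ + ct * β)) * (1 - (β + (β₁ + ct * β)) * (R * cr) * cr)⁻¹) * cr)) ∧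
    0 ≤ (ε₀ * (1 - (β + (β₁ + ct * β)) * (R * cr) * cr)⁻¹) ∧
    0 ≤ (ε₀ * (R * ((((m₀ + oχ * β) + (m₁ + oχ₁ * β₁ + ct * m₀ + oχ₂ * β)) * cr + 1 * (((m₀ + oχ * β) + (m₁ + oχ₁ * β₁ + ct * m₀ + oχ₂ * β)) * cr) * (R * ((β + (β₁ + ct * β)) * (1 - (β + (β₁ + ct * β)) * (R * cr) * cr)⁻¹) * cr) + (β + (β₁ + ct * β)) * o * cr * ((β + (β₁ + ct * β)) * (1 - (β + (β₁ + ct * β)) * (R * cr) * cr)⁻¹) * cr) * (1 - 1 * ((β + (β₁ + ct * β)) * (R * cr) * cr))⁻¹) + o * ((β + (β₁ + ct * β)) * (1 - (β + (β₁ + ct * β)) * (R * cr) * cr)⁻¹)) * cr * cr + rF * (1 + R * ((β + (β₁ + ct * β)) * (1 - (β + (β₁ + ct * β)) * (R * cr) * cr)⁻¹) * cr * cr)) := by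
  have hqi : 0 ≤ (1 - (β + (β₁ + ct * β)) * (R * cr) * cr)⁻¹ := inv_nonneg.2 (sub_nonneg.2 hq.le)
  have hq1 : 0 ≤ (1 - 1 * ((β + (β₁ + ct * β)) * (R * cr) * cr))⁻¹ := by rw [one_mul]; exact hqi
  refine ⟨by positivity, by positivity, by positivity, by positivity, by positivity, by positivity, by positivity⟩

omit [Fintype X] [Fintype X'] [DecidableEq X] [DecidableEq X'] [Fintype ι] [DecidableEq ι] [DecidableEq J] [Fintype K] in
/-- (II) the first summand of file 39's `r₀` is nonnegative. [folklore] -/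
theorem gluedDefect_r0a_nonneg {R o c₁ c₂ o₁ o₂ rW : ℝ} (hβ : 0 ≤ β) (hβ₁ : 0 ≤ β₁) (hct : 0 ≤ ct) (hm₀ : 0 ≤ m₀) (hm₁ : 0 ≤ m₁) (hoχ : 0 ≤ oχ) (hoχ₁ : 0 ≤ oχ₁)
    (hoχ₂ : 0 ≤ oχ₂) (hR : 0 ≤ R) (ho : 0 ≤ o) (hc₁ : 0 ≤ c₁) (hc₂ : 0 ≤ c₂) (ho₁ : 0 ≤ o₁) (ho₂ : 0 ≤ o₂) (hrW : 0 ≤ rW) (hcr : 0 ≤ cr) (hq : (β + (β₁ + ct * β)) * (R * cr) * cr < 1) :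
    0 ≤ (Fintype.card J * (c₂ * ((((m₀ + oχ * β) + (m₁ + oχ₁ * β₁ + ct * m₀ + oχ₂ * β)) * cr + 1 * (((m₀ + oχ * β) + (m₁ + oχ₁ * β₁ + ct * m₀ + oχ₂ * β)) * cr) * (R * ((β + (β₁ + ct * β)) * (1 - (β + (β₁ + ct * β)) * (R * cr) * cr)⁻¹) * cr) + (β + (β₁ + ct * β)) * o * cr * ((β + (β₁ + ct * β)) * (1 - (β + (β₁ + ct * β)) * (R * cr) * cr)⁻¹) * cr) * (1 - 1 * ((β + (β₁ + ct * β)) * (R * cr) * cr))⁻¹)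
              + o₂ * ((β + (β₁ + ct * β)) * (1 - (β + (β₁ + ct * β)) * (R * cr) * cr)⁻¹)
              + 2 * (c₁ * ((((m₀ + oχ * β) + (m₁ + oχ₁ * β₁ + ct * m₀ + oχ₂ * β)) * cr + 1 * (((m₀ + oχ * β) + (m₁ + oχ₁ * β₁ + ct * m₀ + oχ₂ * β)) * cr) * (R * ((β + (β₁ + ct * β)) * (1 - (β + (β₁ + ct * β)) * (R * cr) * cr)⁻¹) * cr) + (β + (β₁ + ct * β)) * o * cr * ((β + (β₁ + ct * β)) * (1 - (β + (β₁ + ct * β)) * (R * cr) * cr)⁻¹) * cr) * (1 - 1 * ((β + (β₁ + ct * β)) * (R * cr) * cr))⁻¹)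
                + o₁ * ((β + (β₁ + ct * β)) * (1 - (β + (β₁ + ct * β)) * (R * cr) * cr)⁻¹))) + rW) := by
  have hqi : 0 ≤ (1 - (β + (β₁ + ct * β)) * (R * cr) * cr)⁻¹ := inv_nonneg.2 (sub_nonneg.2 hq.le)
  have hq1 : 0 ≤ (1 - 1 * ((β + (β₁ + ct * β)) * (R * cr) * cr))⁻¹ := by rw [one_mul]; exact hqi
  positivity

omit [Fintype X] [Fintype X'] [DecidableEq X] [DecidableEq X'] [Fintype ι] [DecidableEq ι] [DecidableEq J] [Fintype K] in
/-- (III) the second summand of file 39's `r₀` is nonnegative. [folklore] -/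
theorem gluedDefect_r0b_nonneg {R o cN rN : ℝ} (hβ : 0 ≤ β) (hβ₁ : 0 ≤ β₁) (hct : 0 ≤ ct) (hm₀ : 0 ≤ m₀) (hm₁ : 0 ≤ m₁) (hoχ : 0 ≤ oχ) (hoχ₁ : 0 ≤ oχ₁) (hoχ₂ : 0 ≤ oχ₂)
    (hR : 0 ≤ R) (ho : 0 ≤ o) (hcN : 0 ≤ cN) (hrN : 0 ≤ rN) (hcr : 0 ≤ cr) (hq : (β + (β₁ + ct * β)) * (R * cr) * cr < 1) :
    0 ≤ (cN * ((((m₀ + oχ * β) + (m₁ + oχ₁ * β₁ + ct * m₀ + oχ₂ * β)) * cr + 1 * (((m₀ + oχ * β) + (m₁ + oχ₁ * β₁ + ct * m₀ + oχ₂ * β)) * cr) * (R * ((β + (β₁ + ct * β)) * (1 - (β + (β₁ + ct * β)) * (R * cr) * cr)⁻¹) * cr) + (β + (β₁ + ct * β)) * o * cr * ((β + (β₁ + ct * β)) * (1 - (β + (β₁ + ct * β)) * (R * cr) * cr)⁻¹) * cr) * (1 - 1 * ((β + (β₁ + ct * β)) * (R * cr) * cr))⁻¹) * cr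
              + rN * ((β + (β₁ + ct * β)) * (1 - (β + (β₁ + ct * β)) * (R * cr) * cr)⁻¹) * cr) := by
  have hqi : 0 ≤ (1 - (β + (β₁ + ct * β)) * (R * cr) * cr)⁻¹ := inv_nonneg.2 (sub_nonneg.2 hq.le)
  have hq1 : 0 ≤ (1 - 1 * ((β + (β₁ + ct * β)) * (R * cr) * cr))⁻¹ := by rw [one_mul]; exact hqi
  positivity

omit [Fintype X] [Fintype X'] [DecidableEq X] [DecidableEq X'] [Fintype ι] [DecidableEq ι] [DecidableEq J] [Fintype K] in
/-- (IV) the third summand of file 39's `r₀` is nonnegative. [folklore] -/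
theorem gluedDefect_r0c_nonneg {R o c₁ o₁ ℓ ω d₁ oo ε : ℝ} (hβ : 0 ≤ β) (hβ₁ : 0 ≤ β₁) (hct : 0 ≤ ct) (hm₀ : 0 ≤ m₀) (hm₁ : 0 ≤ m₁) (hoχ : 0 ≤ oχ) (hoχ₁ : 0 ≤ oχ₁)
    (hoχ₂ : 0 ≤ oχ₂) (hR : 0 ≤ R) (ho : 0 ≤ o) (hε : 0 < ε) (hc₁ : 0 ≤ c₁) (ho₁ : 0 ≤ o₁) (hℓ : 0 ≤ ℓ) (hω : 0 ≤ ω) (hd₁ : 0 ≤ d₁) (hoo : 0 ≤ oo) (hcr : 0 ≤ cr)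
    (hn : 0 < n) (hn' : 0 < n') (hq : (β + (β₁ + ct * β)) * (R * cr) * cr < 1) :
    0 ≤ ((((ℓ * (Real.exp 1 * ε)⁻¹ + 2 * (ω + ℓ * d₁)) * R)
                * ((((m₀ + oχ * β) + (m₁ + oχ₁ * β₁ + ct * m₀ + oχ₂ * β)) * cr + 1 * (((m₀ + oχ * β) + (m₁ + oχ₁ * β₁ + ct * m₀ + oχ₂ * β)) * cr) * (R * ((β + (β₁ + ct * β)) * (1 - (β + (β₁ + ct * β)) * (R * cr) * cr)⁻¹) * cr) + (β + (β₁ + ct * β)) * o * cr * ((β + (β₁ + ct * β)) * (1 - (β + (β₁ + ct * β)) * (R * cr) * cr)⁻¹) * cr) * (1 - 1 * ((β + (β₁ + ct * β)) * (R * cr) * cr))⁻¹)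
              + ((ℓ * (Real.exp 1 * ε)⁻¹ + 2 * (ω + ℓ * d₁)) * o + 2 * R * (oo + c₁ / n' + c₁ / n))
                * ((β + (β₁ + ct * β)) * (1 - (β + (β₁ + ct * β)) * (R * cr) * cr)⁻¹)
              + R * (c₁ * ((((m₀ + oχ * β) + (m₁ + oχ₁ * β₁ + ct * m₀ + oχ₂ * β)) * cr + 1 * (((m₀ + oχ * β) + (m₁ + oχ₁ * β₁ + ct * m₀ + oχ₂ * β)) * cr) * (R * ((β + (β₁ + ct * β)) * (1 - (β + (β₁ + ct * β)) * (R * cr) * cr)⁻¹) * cr) + (β + (β₁ + ct * β)) * o * cr * ((β + (β₁ + ct * β)) * (1 - (β + (β₁ + ct * β)) * (R * cr) * cr)⁻¹) * cr) * (1 - 1 * ((β + (β₁ + ct * β)) * (R * cr) * cr))⁻¹)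
                + o₁ * ((β + (β₁ + ct * β)) * (1 - (β + (β₁ + ct * β)) * (R * cr) * cr)⁻¹))
              + o * c₁ * ((β + (β₁ + ct * β)) * (1 - (β + (β₁ + ct * β)) * (R * cr) * cr)⁻¹)) * cr) := by
  have hqi : 0 ≤ (1 - (β + (β₁ + ct * β)) * (R * cr) * cr)⁻¹ := inv_nonneg.2 (sub_nonneg.2 hq.le)
  have hq1 : 0 ≤ (1 - 1 * ((β + (β₁ + ct * β)) * (R * cr) * cr))⁻¹ := by rw [one_mul]; exact hqi
  positivity

/-- ★★★ **THE TWO-GRID η-DEFECT OF THE GLUED LIVE-BACKGROUND PROPAGATOR FROM DRESSED SMOOTH-CUT CUBES**: under both grids' displayed per-cube rows (file 39's data per cube: bumps, fits,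
insertions, input cuts, FILE 63's cut rows and their defects, the partitions' letters∕fits∕block reading, `V̂, V̂′` with fit `o`, the `W`-rows' defect `r_W`, `[N_L′, M_{h′}]` and its defect
`r_N`), plus the one-grid `W`-rows, `[N_L, M_h]`, `|h|, |h′| ≤ 1`, `M_hM_χ = M_h` (both grids), the tail rows `ε₀e^{−ρ_Td}` and their defect `r_F`, overlap `N_ov`, `β̄Rc_r² < 1`,
`N_ov(θ₀ + ε̄)c_r < 1`, `2σ ≤ ρ₃ ≤ ρ₂`, `ρ₂ + σ ≤ ρ_T`:  `𝔇(𝒢′, 𝒢) ≤ C·e^{−(ρ₃−2σ)d}` with `C` = file 32's constant at (`β̄′, θ₀, ε̄, m = A_D, r = r₀, r_E, oo, N_ov`) — written out below.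
[cite: Balaban1985BackgroundPropagators, Thm 3.14 pp.426–427 (template), (3.62)–(3.65) pp.402–403, p.399; Balaban1984PropagatorsII, (2.91) p.239, (2.133)–(2.136) p.247 (mechanism)] -/
theorem hasMaj_idef_glueInv_smoothCutDressed (htri : Triangle254 g) (hd : ∀ a b : g.Site, 0 ≤ g.dist a b) (hd0 : ∀ y : g.Site, g.dist y y = 0)
    (hsymm : ∀ y y', g.dist y y' = g.dist y' y) (hrow : RowSum g σ cr) (hσ : 0 ≤ σ) (hcr : 0 ≤ cr)
    {ρ₁ ρ₂ ρ₃ ρN ρT δV ε R o c₁ c₂ o₁ o₂ rW θW cN rN ℓ ω d₁ oo ε₀ rF Nov : ℝ} (hβ : 0 ≤ β) (hβ₁ : 0 ≤ β₁) (hct : 0 ≤ ct) (hm₀ : 0 ≤ m₀) (hm₁ : 0 ≤ m₁)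
    (hoχ : 0 ≤ oχ) (hoχ₁ : 0 ≤ oχ₁) (hoχ₂ : 0 ≤ oχ₂) (hR : 0 ≤ R) (ho : 0 ≤ o) (hσρ : σ ≤ ρ₁) (hρ₁V : ρ₁ ≤ δV) (hρ₁G : ρ₁ + σ ≤ δ) (hρ₂ : 0 ≤ ρ₂) (hρ₂₁ : ρ₂ + σ ≤ ρ₁)
    (hρ₂T : ρ₂ + σ ≤ ρT) (hρ₃ : 0 ≤ ρ₃) (hρ₃₂ : ρ₃ ≤ ρ₂) (hρ₃V : ρ₃ + σ ≤ δV - ε) (hρ₃N : ρ₃ + σ ≤ ρN) (hσρ₃ : 2 * σ ≤ ρ₃) (hε : 0 < ε) (hc₁ : 0 ≤ c₁) (hc₂ : 0 ≤ c₂)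
    (ho₁ : 0 ≤ o₁) (ho₂ : 0 ≤ o₂) (hrW : 0 ≤ rW) (hθW : 0 ≤ θW) (hcN : 0 ≤ cN) (hrN : 0 ≤ rN) (hℓ : 0 ≤ ℓ) (hω : 0 ≤ ω) (hd₁ : 0 ≤ d₁) (hoo : 0 ≤ oo) (hε₀ : 0 ≤ ε₀)
    (hrF : 0 ≤ rF) (hNov : 0 ≤ Nov) (hn : 0 < n) (hn' : 0 < n')
    (hSχ : ∀ k, ∀ x, (χX k) x ≠ 0 → blk x ∈ (Sk k)) (hSψ : ∀ k, ∀ x, (ψX k) x ≠ 0 → blk x ∈ (Sk k)) (hSχ' : ∀ k, ∀ x', (χX' k) x' ≠ 0 → blk (π x') ∈ (Sk k)) (hSψ' : ∀ k, ∀ x', (ψX' k) x' ≠ 0 → blk (π x') ∈ (Sk k))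
    -- coarse bump data
    (hχt : ∀ k, ∀ x, |(χtX k) x| ≤ 1)
    (hdχt : ∀ k, ∀ μ p, |fgrad n (liftEquiv (τ μ) ι) (fun p : X × ι => (χtX k) p.1) p| ≤ ct) (hdχtb : ∀ k, ∀ μ p, |bgrad n (liftEquiv (τ μ) ι) (fun p : X × ι => (χtX k) p.1) p| ≤ ct)
    (hsub : ∀ k, mulOp (fun p : X × ι => (χtX k) p.1) ∘ₗ mulOp (fun p : X × ι => (χX k) p.1) = mulOp (fun p : X × ι => (χtX k) p.1))
    (hχ : ∀ k, mulOp (fun p : X × ι => (χX k) p.1) ∘ₗ mulOp (fun p : X × ι => (χtX k) p.1) = mulOp (fun p : X × ι => (χtX k) p.1))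
    (hs : ∀ k, ∀ μ, mulOp ((fun p : X × ι => (χtX k) p.1) ∘ (liftEquiv (τ μ) ι)) ∘ₗ mulOp (fun p : X × ι => (χX k) p.1) = mulOp ((fun p : X × ι => (χtX k) p.1) ∘ (liftEquiv (τ μ) ι)))
    (hsb : ∀ k, ∀ μ, mulOp ((fun p : X × ι => (χtX k) p.1) ∘ (liftEquiv (τ μ) ι).symm) ∘ₗ mulOp (fun p : X × ι => (χX k) p.1) = mulOp ((fun p : X × ι => (χtX k) p.1) ∘ (liftEquiv (τ μ) ι).symm))
    (hdd : ∀ k, ∀ μ, mulOp (fgrad n (liftEquiv (τ μ) ι) (fun p : X × ι => (χtX k) p.1)) ∘ₗ mulOp (fun p : X × ι => (χX k) p.1) = mulOp (fgrad n (liftEquiv (τ μ) ι) (fun p : X × ι => (χtX k) p.1)))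
    (hddb : ∀ k, ∀ μ, mulOp (bgrad n (liftEquiv (τ μ) ι) (fun p : X × ι => (χtX k) p.1)) ∘ₗ mulOp (fun p : X × ι => (χX k) p.1) = mulOp (bgrad n (liftEquiv (τ μ) ι) (fun p : X × ι => (χtX k) p.1)))
    (hNψ : ∀ k, (N k) ∘ₗ mulOp (fun p : X × ι => (ψX k) p.1) = (N k))
    -- fine bump data
    (hχt' : ∀ k, ∀ x', |(χtX' k) x'| ≤ 1)
    (hdχt' : ∀ k, ∀ μ p', |fgrad n' (liftEquiv (τ' μ) ι) (fun p' : X' × ι => (χtX' k) p'.1) p'| ≤ ct) (hdχtb' : ∀ k, ∀ μ p', |bgrad n' (liftEquiv (τ' μ) ι) (fun p' : X' × ι => (χtX' k) p'.1) p'| ≤ ct)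
    (hsub' : ∀ k, mulOp (fun p : X' × ι => (χtX' k) p.1) ∘ₗ mulOp (fun p : X' × ι => (χX' k) p.1) = mulOp (fun p : X' × ι => (χtX' k) p.1))
    (hχ' : ∀ k, mulOp (fun p : X' × ι => (χX' k) p.1) ∘ₗ mulOp (fun p : X' × ι => (χtX' k) p.1) = mulOp (fun p : X' × ι => (χtX' k) p.1))
    (hs' : ∀ k, ∀ μ, mulOp ((fun p' : X' × ι => (χtX' k) p'.1) ∘ (liftEquiv (τ' μ) ι)) ∘ₗ mulOp (fun p' : X' × ι => (χX' k) p'.1) = mulOp ((fun p' : X' × ι => (χtX' k) p'.1) ∘ (liftEquiv (τ' μ) ι)))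
    (hsb' : ∀ k, ∀ μ, mulOp ((fun p' : X' × ι => (χtX' k) p'.1) ∘ (liftEquiv (τ' μ) ι).symm) ∘ₗ mulOp (fun p' : X' × ι => (χX' k) p'.1) =
      mulOp ((fun p' : X' × ι => (χtX' k) p'.1) ∘ (liftEquiv (τ' μ) ι).symm))
    (hdd' : ∀ k, ∀ μ, mulOp (fgrad n' (liftEquiv (τ' μ) ι) (fun p' : X' × ι => (χtX' k) p'.1)) ∘ₗ mulOp (fun p' : X' × ι => (χX' k) p'.1) = mulOp (fgrad n' (liftEquiv (τ' μ) ι) (fun p' : X' × ι => (χtX' k) p'.1)))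
    (hddb' : ∀ k, ∀ μ, mulOp (bgrad n' (liftEquiv (τ' μ) ι) (fun p' : X' × ι => (χtX' k) p'.1)) ∘ₗ mulOp (fun p' : X' × ι => (χX' k) p'.1) = mulOp (bgrad n' (liftEquiv (τ' μ) ι) (fun p' : X' × ι => (χtX' k) p'.1)))
    (hNψ' : ∀ k, (N' k) ∘ₗ mulOp (fun p : X' × ι => (ψX' k) p.1) = (N' k))
    -- fits of the bumps across `π`
    (hfitχ : ∀ k, ∀ x', |(χtX' k) x' - (χtX k) (π x')| ≤ oχ)
    (hfit₁ : ∀ k, ∀ μ p', |((fun p' : X' × ι => (χtX' k) p'.1) ∘ (liftEquiv (τ' μ) ι)) p' - ((fun p : X × ι => (χtX k) p.1) ∘ (liftEquiv (τ μ) ι)) (liftMap π ι p')| ≤ oχ₁)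
    (hfit₁b : ∀ k, ∀ μ p', |((fun p' : X' × ι => (χtX' k) p'.1) ∘ (liftEquiv (τ' μ) ι).symm) p' - ((fun p : X × ι => (χtX k) p.1) ∘ (liftEquiv (τ μ) ι).symm) (liftMap π ι p')| ≤ oχ₁)
    (hfit₂ : ∀ k, ∀ μ p', |fgrad n' (liftEquiv (τ' μ) ι) (fun p' : X' × ι => (χtX' k) p'.1) p' - fgrad n (liftEquiv (τ μ) ι) (fun p : X × ι => (χtX k) p.1) (liftMap π ι p')| ≤ oχ₂)
    (hfit₂b : ∀ k, ∀ μ p', |bgrad n' (liftEquiv (τ' μ) ι) (fun p' : X' × ι => (χtX' k) p'.1) p' - bgrad n (liftEquiv (τ μ) ι) (fun p : X × ι => (χtX k) p.1) (liftMap π ι p')| ≤ oχ₂)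
    -- cut rows and their defects
    (hcut : ∀ k, HasMaj (BlockNorm.ofBlocks g (liftBlk blk ι)) (BlockNorm.ofBlocks g (liftBlk blk ι)) (mulOp (fun p : X × ι => (χX k) p.1) ∘ₗ (N k))
      (fun y y' => ind (Sk k) y * ind (Sk k) y' * (β * Real.exp (-(δ * g.dist y y')))))
    (hcutF : ∀ k, ∀ μ, HasMaj (BlockNorm.ofBlocks g (liftBlk blk ι)) (BlockNorm.ofBlocks g (liftBlk blk ι)) (mulOp (fun p : X × ι => (χX k) p.1) ∘ₗ (fgrad n (liftEquiv (τ μ) ι) ∘ₗ (N k)))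
      (fun y y' => ind (Sk k) y * ind (Sk k) y' * (β₁ * Real.exp (-(δ * g.dist y y')))))
    (hcutB : ∀ k, ∀ μ, HasMaj (BlockNorm.ofBlocks g (liftBlk blk ι)) (BlockNorm.ofBlocks g (liftBlk blk ι)) (mulOp (fun p : X × ι => (χX k) p.1) ∘ₗ (bgrad n (liftEquiv (τ μ) ι) ∘ₗ (N k)))
      (fun y y' => ind (Sk k) y * ind (Sk k) y' * (β₁ * Real.exp (-(δ * g.dist y y')))))
    (hcut' : ∀ k, HasMaj (BlockNorm.ofBlocks g (liftBlk (blk ∘ π) ι)) (BlockNorm.ofBlocks g (liftBlk (blk ∘ π) ι)) (mulOp (fun p : X' × ι => (χX' k) p.1) ∘ₗ (N' k))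
      (fun y y' => ind (Sk k) y * ind (Sk k) y' * (β * Real.exp (-(δ * g.dist y y')))))
    (hcutF' : ∀ k, ∀ μ, HasMaj (BlockNorm.ofBlocks g (liftBlk (blk ∘ π) ι)) (BlockNorm.ofBlocks g (liftBlk (blk ∘ π) ι)) (mulOp (fun p : X' × ι => (χX' k) p.1) ∘ₗ (fgrad n' (liftEquiv (τ' μ) ι) ∘ₗ (N' k)))
      (fun y y' => ind (Sk k) y * ind (Sk k) y' * (β₁ * Real.exp (-(δ * g.dist y y')))))
    (hcutB' : ∀ k, ∀ μ, HasMaj (BlockNorm.ofBlocks g (liftBlk (blk ∘ π) ι)) (BlockNorm.ofBlocks g (liftBlk (blk ∘ π) ι)) (mulOp (fun p : X' × ι => (χX' k) p.1) ∘ₗ (bgrad n' (liftEquiv (τ' μ) ι) ∘ₗ (N' k)))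
      (fun y y' => ind (Sk k) y * ind (Sk k) y' * (β₁ * Real.exp (-(δ * g.dist y y')))))
    (hDcut : ∀ k, HasMaj (BlockNorm.ofBlocks g (liftBlk blk ι)) (BlockNorm.ofBlocks g (liftBlk blk ι ∘ liftMap π ι))
      (idef (pull (liftMap π ι)) (pull (liftMap π ι)) (mulOp (fun p : X' × ι => (χX' k) p.1) ∘ₗ (N' k)) (mulOp (fun p : X × ι => (χX k) p.1) ∘ₗ (N k)))
      (fun y y' => ind (Sk k) y * ind (Sk k) y' * (m₀ * Real.exp (-(δ * g.dist y y')))))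
    (hDcutF : ∀ k, ∀ μ, HasMaj (BlockNorm.ofBlocks g (liftBlk blk ι)) (BlockNorm.ofBlocks g (liftBlk blk ι ∘ liftMap π ι))
      (idef (pull (liftMap π ι)) (pull (liftMap π ι)) (mulOp (fun p : X' × ι => (χX' k) p.1) ∘ₗ (fgrad n' (liftEquiv (τ' μ) ι) ∘ₗ (N' k))) (mulOp (fun p : X × ι => (χX k) p.1) ∘ₗ (fgrad n (liftEquiv (τ μ) ι) ∘ₗ (N k))))
      (fun y y' => ind (Sk k) y * ind (Sk k) y' * (m₁ * Real.exp (-(δ * g.dist y y')))))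
    (hDcutB : ∀ k, ∀ μ, HasMaj (BlockNorm.ofBlocks g (liftBlk blk ι)) (BlockNorm.ofBlocks g (liftBlk blk ι ∘ liftMap π ι))
      (idef (pull (liftMap π ι)) (pull (liftMap π ι)) (mulOp (fun p : X' × ι => (χX' k) p.1) ∘ₗ (bgrad n' (liftEquiv (τ' μ) ι) ∘ₗ (N' k))) (mulOp (fun p : X × ι => (χX k) p.1) ∘ₗ (bgrad n (liftEquiv (τ μ) ι) ∘ₗ (N k))))
      (fun y y' => ind (Sk k) y * ind (Sk k) y' * (m₁ * Real.exp (-(δ * g.dist y y')))))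
    -- the jet pieces' reversed insertions (output cut-offs), both grids
    (hs2 : ∀ k, ∀ μ, mulOp (fun p : X × ι => (χX k) p.1) ∘ₗ mulOp ((fun p : X × ι => (χtX k) p.1) ∘ (liftEquiv (τ μ) ι)) = mulOp ((fun p : X × ι => (χtX k) p.1) ∘ (liftEquiv (τ μ) ι)))
    (hsb2 : ∀ k, ∀ μ, mulOp (fun p : X × ι => (χX k) p.1) ∘ₗ mulOp ((fun p : X × ι => (χtX k) p.1) ∘ (liftEquiv (τ μ) ι).symm) = mulOp ((fun p : X × ι => (χtX k) p.1) ∘ (liftEquiv (τ μ) ι).symm))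
    (hdd2 : ∀ k, ∀ μ, mulOp (fun p : X × ι => (χX k) p.1) ∘ₗ mulOp (fgrad n (liftEquiv (τ μ) ι) (fun p : X × ι => (χtX k) p.1)) = mulOp (fgrad n (liftEquiv (τ μ) ι) (fun p : X × ι => (χtX k) p.1)))
    (hddb2 : ∀ k, ∀ μ, mulOp (fun p : X × ι => (χX k) p.1) ∘ₗ mulOp (bgrad n (liftEquiv (τ μ) ι) (fun p : X × ι => (χtX k) p.1)) = mulOp (bgrad n (liftEquiv (τ μ) ι) (fun p : X × ι => (χtX k) p.1)))
    (hs2' : ∀ k, ∀ μ, mulOp (fun p' : X' × ι => (χX' k) p'.1) ∘ₗ mulOp ((fun p' : X' × ι => (χtX' k) p'.1) ∘ (liftEquiv (τ' μ) ι)) = mulOp ((fun p' : X' × ι => (χtX' k) p'.1) ∘ (liftEquiv (τ' μ) ι)))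
    (hsb2' : ∀ k, ∀ μ, mulOp (fun p' : X' × ι => (χX' k) p'.1) ∘ₗ mulOp ((fun p' : X' × ι => (χtX' k) p'.1) ∘ (liftEquiv (τ' μ) ι).symm) =
      mulOp ((fun p' : X' × ι => (χtX' k) p'.1) ∘ (liftEquiv (τ' μ) ι).symm))
    (hdd2' : ∀ k, ∀ μ, mulOp (fun p' : X' × ι => (χX' k) p'.1) ∘ₗ mulOp (fgrad n' (liftEquiv (τ' μ) ι) (fun p' : X' × ι => (χtX' k) p'.1)) = mulOp (fgrad n' (liftEquiv (τ' μ) ι) (fun p' : X' × ι => (χtX' k) p'.1)))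
    (hddb2' : ∀ k, ∀ μ, mulOp (fun p' : X' × ι => (χX' k) p'.1) ∘ₗ mulOp (bgrad n' (liftEquiv (τ' μ) ι) (fun p' : X' × ι => (χtX' k) p'.1)) = mulOp (bgrad n' (liftEquiv (τ' μ) ι) (fun p' : X' × ι => (χtX' k) p'.1)))
    (hV : HasMaj (BlockNorm.ofBlocks g (blkPair (liftBlk blk ι))) (BlockNorm.ofBlocks g (liftBlk blk ι)) V (fun y y' => R * Real.exp (-(δV * g.dist y y'))))
    (hV' : HasMaj (BlockNorm.ofBlocks g (blkPair (liftBlk (blk ∘ π) ι))) (BlockNorm.ofBlocks g (liftBlk (blk ∘ π) ι)) V' (fun y y' => R * Real.exp (-(δV * g.dist y y'))))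
    (hDV : HasMaj (BlockNorm.ofBlocks g (blkPair (liftBlk blk ι))) (BlockNorm.ofBlocks g (liftBlk (blk ∘ π) ι))
      (idef (pull (liftPair (liftMap π ι))) (pull (liftMap π ι)) V' V) (fun y y' => o * Real.exp (-(δV * g.dist y y'))))
    (hq : (β + (β₁ + ct * β)) * (R * cr) * cr < 1)
    (hh1 : ∀ k, ∀ μ p, |fgrad n (liftEquiv (τ μ) ι) (h k) p| ≤ c₁) (hh1b : ∀ k, ∀ μ p, |bgrad n (liftEquiv (τ μ) ι) (h k) p| ≤ c₁)
    (hh1' : ∀ k, ∀ μ p', |fgrad n' (liftEquiv (τ' μ) ι) (h' k) p'| ≤ c₁) (hh1b' : ∀ k, ∀ μ p', |bgrad n' (liftEquiv (τ' μ) ι) (h' k) p'| ≤ c₁)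
    (hh2' : ∀ k, ∀ μ p', |fgradAdj n' (liftEquiv (τ' μ) ι) (fgrad n' (liftEquiv (τ' μ) ι) (h' k)) p'| ≤ c₂)
    (hf1 : ∀ k, ∀ μ p', |fgrad n' (liftEquiv (τ' μ) ι) (h' k) p' - fgrad n (liftEquiv (τ μ) ι) (h k) (liftMap π ι p')| ≤ o₁)
    (hf1b : ∀ k, ∀ μ p', |bgrad n' (liftEquiv (τ' μ) ι) (h' k) p' - bgrad n (liftEquiv (τ μ) ι) (h k) (liftMap π ι p')| ≤ o₁)
    (hf2 : ∀ k, ∀ μ p', |fgradAdj n' (liftEquiv (τ' μ) ι) (fgrad n' (liftEquiv (τ' μ) ι) (h' k)) p' - fgradAdj n (liftEquiv (τ μ) ι) (fgrad n (liftEquiv (τ μ) ι) (h k)) (liftMap π ι p')| ≤ o₂)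
    (hLip : ∀ k, ∀ y y', |(hb k) y - (hb k) y'| ≤ ℓ * g.dist y y') (hrh : ∀ k, ∀ p, |(h k) p - (hb k) (liftBlk blk ι p)| ≤ ω) (hrh' : ∀ k, ∀ p', |(h' k) p' - (hb k) (liftBlk (blk ∘ π) ι p')| ≤ ω)
    (hfh : ∀ k, ∀ p', |(h' k) p' - (h k) (liftMap π ι p')| ≤ oo) (hstep : ∀ μ x, g.dist (blk (τ μ x)) (blk x) ≤ d₁) (hstep' : ∀ μ x', g.dist (blk (π (τ' μ x'))) (blk (π x')) ≤ d₁)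
    (hDW : ∀ k, HasMaj (BlockNorm.ofBlocks g (liftBlk blk ι)) (BlockNorm.ofBlocks g (liftBlk (blk ∘ π) ι))
      (idef (pull (liftMap π ι)) (pull (liftMap π ι)) (commOp W' (h' k) ∘ₗ (projO none ∘ₗ bgPropV (stack (mulOp (fun p : X' × ι => (χtX' k) p.1) ∘ₗ (N' k))
          (fun j => Sum.elim (fun μ => fgrad n' (liftEquiv (τ' μ) ι)) (fun μ => bgrad n' (liftEquiv (τ' μ) ι)) j ∘ₗ (mulOp (fun p : X' × ι => (χtX' k) p.1) ∘ₗ (N' k)))) V')) (commOp W (h k) ∘ₗ (projO none ∘ₗ bgPropV (stack (mulOp (fun p : X × ι => (χtX k) p.1) ∘ₗ (N k))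
          (fun j => Sum.elim (fun μ => fgrad n (liftEquiv (τ μ) ι)) (fun μ => bgrad n (liftEquiv (τ μ) ι)) j ∘ₗ (mulOp (fun p : X × ι => (χtX k) p.1) ∘ₗ (N k)))) V)))
      (fun y y' => ind (Sk k) y * ind (Sk k) y' * (rW * Real.exp (-(ρ₂ * g.dist y y')))))
    (hKN' : ∀ k, HasMaj (BlockNorm.ofBlocks g (liftBlk (blk ∘ π) ι)) (BlockNorm.ofBlocks g (liftBlk (blk ∘ π) ι)) (commOp NL' (h' k)) (fun y y' => cN * Real.exp (-(ρN * g.dist y y'))))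
    (hDKN : ∀ k, HasMaj (BlockNorm.ofBlocks g (liftBlk blk ι)) (BlockNorm.ofBlocks g (liftBlk (blk ∘ π) ι))
      (idef (pull (liftMap π ι)) (pull (liftMap π ι)) (commOp NL' (h' k)) (commOp NL (h k))) (fun y y' => rN * Real.exp (-(ρN * g.dist y y'))))

    -- per cube, beyond file 39's data: the coarse second differences, the one-grid `W`-rows at both grids, the coarse `[N_L, M_h]` letter, the partition's sizes and cut support, the tail rows and their defect
    (hh2 : ∀ k, ∀ μ p, |fgradAdj n (liftEquiv (τ μ) ι) (fgrad n (liftEquiv (τ μ) ι) (h k)) p| ≤ c₂)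
    (hW : ∀ k, HasMaj (BlockNorm.ofBlocks g (liftBlk blk ι)) (BlockNorm.ofBlocks g (liftBlk blk ι)) (commOp W (h k) ∘ₗ (projO none ∘ₗ bgPropV (stack (mulOp (fun p : X × ι => χtX k p.1) ∘ₗ N k)
          (fun j => Sum.elim (fun μ => fgrad n (liftEquiv (τ μ) ι)) (fun μ => bgrad n (liftEquiv (τ μ) ι)) j ∘ₗ (mulOp (fun p : X × ι => χtX k p.1) ∘ₗ N k))) V))
      (fun y y' => ind (Sk k) y * ind (Sk k) y' * (θW * Real.exp (-(ρ₂ * g.dist y y')))))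
    (hW' : ∀ k, HasMaj (BlockNorm.ofBlocks g (liftBlk (blk ∘ π) ι)) (BlockNorm.ofBlocks g (liftBlk (blk ∘ π) ι)) (commOp W' (h' k) ∘ₗ (projO none ∘ₗ bgPropV (stack (mulOp (fun p : X' × ι => χtX' k p.1) ∘ₗ N' k)
          (fun j => Sum.elim (fun μ => fgrad n' (liftEquiv (τ' μ) ι)) (fun μ => bgrad n' (liftEquiv (τ' μ) ι)) j ∘ₗ (mulOp (fun p : X' × ι => χtX' k p.1) ∘ₗ N' k))) V'))
      (fun y y' => ind (Sk k) y * ind (Sk k) y' * (θW * Real.exp (-(ρ₂ * g.dist y y')))))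
    (hKN : ∀ k, HasMaj (BlockNorm.ofBlocks g (liftBlk blk ι)) (BlockNorm.ofBlocks g (liftBlk blk ι)) (commOp NL (h k)) (fun y y' => cN * Real.exp (-(ρN * g.dist y y'))))
    (hhabs : ∀ k, ∀ p, |h k p| ≤ 1) (hhabs' : ∀ k, ∀ p', |h' k p'| ≤ 1)
    (hhcut : ∀ k, mulOp (h k) ∘ₗ mulOp (fun p : X × ι => χX k p.1) = mulOp (h k)) (hhcut' : ∀ k, mulOp (h' k) ∘ₗ mulOp (fun p : X' × ι => χX' k p.1) = mulOp (h' k))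
    (hN : ∀ b, ∑ k, ind (Sk k) b ≤ Nov)
    (hT : ∀ k, HasMaj (BlockNorm.ofBlocks g (liftBlk blk ι)) (BlockNorm.ofBlocks g (liftBlk blk ι)) ((-(mulOp (h k) ∘ₗ NL ∘ₗ mulOp (1 - fun p : X × ι => χtX k p.1))) ∘ₗ N k) (fun y y' => ind (Sk k) y * ind (Sk k) y' * (ε₀ * Real.exp (-(ρT * g.dist y y')))))
    (hT' : ∀ k, HasMaj (BlockNorm.ofBlocks g (liftBlk (blk ∘ π) ι)) (BlockNorm.ofBlocks g (liftBlk (blk ∘ π) ι)) ((-(mulOp (h' k) ∘ₗ NL' ∘ₗ mulOp (1 - fun p : X' × ι => χtX' k p.1))) ∘ₗ N' k) (fun y y' => ind (Sk k) y * ind (Sk k) y' * (ε₀ * Real.exp (-(ρT * g.dist y y')))))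
    (hDT : ∀ k, HasMaj (BlockNorm.ofBlocks g (liftBlk blk ι)) (BlockNorm.ofBlocks g (liftBlk (blk ∘ π) ι)) (idef (pull (liftMap π ι)) (pull (liftMap π ι)) ((-(mulOp (h' k) ∘ₗ NL' ∘ₗ mulOp (1 - fun p : X' × ι => χtX' k p.1))) ∘ₗ N' k) ((-(mulOp (h k) ∘ₗ NL ∘ₗ mulOp (1 - fun p : X × ι => χtX k p.1))) ∘ₗ N k)) (fun y y' => ind (Sk k) y * ind (Sk k) y' * (rF * Real.exp (-(ρT * g.dist y y')))))
    (hq' : Nov * ((((Fintype.card J : ℝ) * (c₂ * ((β + (β₁ + ct * β)) * (1 - (β + (β₁ + ct * β)) * (R * cr) * cr)⁻¹) + 2 * (c₁ * ((β + (β₁ + ct * β)) * (1 - (β + (β₁ + ct * β)) * (R * cr) * cr)⁻¹))) + θW + cN * ((β + (β₁ + ct * β)) * (1 - (β + (β₁ + ct * β)) * (R * cr) * cr)⁻¹) * cr)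
          + ((ℓ * (Real.exp 1 * ε)⁻¹ + 2 * (ω + ℓ * d₁)) * R * ((β + (β₁ + ct * β)) * (1 - (β + (β₁ + ct * β)) * (R * cr) * cr)⁻¹) * cr + R * c₁ * ((β + (β₁ + ct * β)) * (1 - (β + (β₁ + ct * β)) * (R * cr) * cr)⁻¹) * cr)) + (ε₀ * (1 - (β + (β₁ + ct * β)) * (R * cr) * cr)⁻¹)) * cr < 1) :
    HasMaj (BlockNorm.ofBlocks g (liftBlk blk ι)) (BlockNorm.ofBlocks g (liftBlk (blk ∘ π) ι))
      (idef (pull (liftMap π ι)) (pull (liftMap π ι))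
        (glueInv (parametrix h' (fun k => projO none ∘ₗ bgPropV (stack (mulOp (fun p : X' × ι => χtX' k p.1) ∘ₗ N' k)
          (fun j => Sum.elim (fun μ => fgrad n' (liftEquiv (τ' μ) ι)) (fun μ => bgrad n' (liftEquiv (τ' μ) ι)) j ∘ₗ (mulOp (fun p : X' × ι => χtX' k p.1) ∘ₗ N' k))) V'))
          (remainder (lapOp n' (fun μ => liftEquiv (τ' μ) ι) W' + NL' - V' ∘ₗ stack LinearMap.id (fun j => Sum.elim (fun μ => fgrad n' (liftEquiv (τ' μ) ι)) (fun μ => bgrad n' (liftEquiv (τ' μ) ι)) j)) h' (fun k => projO none ∘ₗ bgPropV (stack (mulOp (fun p : X' × ι => χtX' k p.1) ∘ₗ N' k)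
          (fun j => Sum.elim (fun μ => fgrad n' (liftEquiv (τ' μ) ι)) (fun μ => bgrad n' (liftEquiv (τ' μ) ι)) j ∘ₗ (mulOp (fun p : X' × ι => χtX' k p.1) ∘ₗ N' k))) V')
            - ∑ k, (fun k => ((-(mulOp (h' k) ∘ₗ NL' ∘ₗ mulOp (1 - fun p : X' × ι => χtX' k p.1))) ∘ₗ N' k) ∘ₗ
          (LinearMap.id + (V' ∘ₗ stack LinearMap.id (fun j => Sum.elim (fun μ => fgrad n' (liftEquiv (τ' μ) ι)) (fun μ => bgrad n' (liftEquiv (τ' μ) ι)) j)) ∘ₗ (projO none ∘ₗ bgPropV (stack (mulOp (fun p : X' × ι => χtX' k p.1) ∘ₗ N' k)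
          (fun j => Sum.elim (fun μ => fgrad n' (liftEquiv (τ' μ) ι)) (fun μ => bgrad n' (liftEquiv (τ' μ) ι)) j ∘ₗ (mulOp (fun p : X' × ι => χtX' k p.1) ∘ₗ N' k))) V'))) k ∘ₗ mulOp (h' k)))
        (glueInv (parametrix h (fun k => projO none ∘ₗ bgPropV (stack (mulOp (fun p : X × ι => χtX k p.1) ∘ₗ N k)
          (fun j => Sum.elim (fun μ => fgrad n (liftEquiv (τ μ) ι)) (fun μ => bgrad n (liftEquiv (τ μ) ι)) j ∘ₗ (mulOp (fun p : X × ι => χtX k p.1) ∘ₗ N k))) V))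
          (remainder (lapOp n (fun μ => liftEquiv (τ μ) ι) W + NL - V ∘ₗ stack LinearMap.id (fun j => Sum.elim (fun μ => fgrad n (liftEquiv (τ μ) ι)) (fun μ => bgrad n (liftEquiv (τ μ) ι)) j)) h (fun k => projO none ∘ₗ bgPropV (stack (mulOp (fun p : X × ι => χtX k p.1) ∘ₗ N k)
          (fun j => Sum.elim (fun μ => fgrad n (liftEquiv (τ μ) ι)) (fun μ => bgrad n (liftEquiv (τ μ) ι)) j ∘ₗ (mulOp (fun p : X × ι => χtX k p.1) ∘ₗ N k))) V)
            - ∑ k, (fun k => ((-(mulOp (h k) ∘ₗ NL ∘ₗ mulOp (1 - fun p : X × ι => χtX k p.1))) ∘ₗ N k) ∘ₗ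
          (LinearMap.id + (V ∘ₗ stack LinearMap.id (fun j => Sum.elim (fun μ => fgrad n (liftEquiv (τ μ) ι)) (fun μ => bgrad n (liftEquiv (τ μ) ι)) j)) ∘ₗ (projO none ∘ₗ bgPropV (stack (mulOp (fun p : X × ι => χtX k p.1) ∘ₗ N k)
          (fun j => Sum.elim (fun μ => fgrad n (liftEquiv (τ μ) ι)) (fun μ => bgrad n (liftEquiv (τ μ) ι)) j ∘ₗ (mulOp (fun p : X × ι => χtX k p.1) ∘ₗ N k))) V))) k ∘ₗ mulOp (h k))))
      (fun y y' => (Nov * ((β + (β₁ + ct * β)) * (1 - (β + (β₁ + ct * β)) * (R * cr) * cr)⁻¹) * ((1 - Nov * ((((Fintype.card J : ℝ) * (c₂ * ((β + (β₁ + ct * β)) * (1 - (β + (β₁ + ct * β)) * (R * cr) * cr)⁻¹) + 2 * (c₁ * ((β + (β₁ + ct * β)) * (1 - (β + (β₁ + ct * β)) * (R * cr) * cr)⁻¹))) + θW + cN * ((β + (β₁ + ct * β)) * (1 - (β + (β₁ + ct * β)) * (R * cr) * cr)⁻¹) * cr)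
          + ((ℓ * (Real.exp 1 * ε)⁻¹ + 2 * (ω + ℓ * d₁)) * R * ((β + (β₁ + ct * β)) * (1 - (β + (β₁ + ct * β)) * (R * cr) * cr)⁻¹) * cr + R * c₁ * ((β + (β₁ + ct * β)) * (1 - (β + (β₁ + ct * β)) * (R * cr) * cr)⁻¹) * cr)) + (ε₀ * (1 - (β + (β₁ + ct * β)) * (R * cr) * cr)⁻¹)) * cr)⁻¹ * ((1 - Nov * ((((Fintype.card J : ℝ) * (c₂ * ((β + (β₁ + ct * β)) * (1 - (β + (β₁ + ct * β)) * (R * cr) * cr)⁻¹) + 2 * (c₁ * ((β + (β₁ + ct * β)) * (1 - (β + (β₁ + ct * β)) * (R * cr) * cr)⁻¹))) + θW + cN * ((β + (β₁ + ct * β)) * (1 - (β + (β₁ + ct * β)) * (R * cr) * cr)⁻¹) * cr)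
          + ((ℓ * (Real.exp 1 * ε)⁻¹ + 2 * (ω + ℓ * d₁)) * R * ((β + (β₁ + ct * β)) * (1 - (β + (β₁ + ct * β)) * (R * cr) * cr)⁻¹) * cr + R * c₁ * ((β + (β₁ + ct * β)) * (1 - (β + (β₁ + ct * β)) * (R * cr) * cr)⁻¹) * cr)) + (ε₀ * (1 - (β + (β₁ + ct * β)) * (R * cr) * cr)⁻¹)) * cr)⁻¹ * (Nov * ((((Fintype.card J : ℝ) * (c₂ * ((β + (β₁ + ct * β)) * (1 - (β + (β₁ + ct * β)) * (R * cr) * cr)⁻¹) + 2 * (c₁ * ((β + (β₁ + ct * β)) * (1 - (β + (β₁ + ct * β)) * (R * cr) * cr)⁻¹))) + θW + cN * ((β + (β₁ + ct * β)) * (1 - (β + (β₁ + ct * β)) * (R * cr) * cr)⁻¹) * cr)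
          + ((ℓ * (Real.exp 1 * ε)⁻¹ + 2 * (ω + ℓ * d₁)) * R * ((β + (β₁ + ct * β)) * (1 - (β + (β₁ + ct * β)) * (R * cr) * cr)⁻¹) * cr + R * c₁ * ((β + (β₁ + ct * β)) * (1 - (β + (β₁ + ct * β)) * (R * cr) * cr)⁻¹) * cr)) * oo + (((Fintype.card J * (c₂ * ((((m₀ + oχ * β) + (m₁ + oχ₁ * β₁ + ct * m₀ + oχ₂ * β)) * cr + 1 * (((m₀ + oχ * β) + (m₁ + oχ₁ * β₁ + ct * m₀ + oχ₂ * β)) * cr) * (R * ((β + (β₁ + ct * β)) * (1 - (β + (β₁ + ct * β)) * (R * cr) * cr)⁻¹) * cr) + (β + (β₁ + ct * β)) * o * cr * ((β + (β₁ + ct * β)) * (1 - (β + (β₁ + ct * β)) * (R * cr) * cr)⁻¹) * cr) * (1 - 1 * ((β + (β₁ + ct * β)) * (R * cr) * cr))⁻¹)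
              + o₂ * ((β + (β₁ + ct * β)) * (1 - (β + (β₁ + ct * β)) * (R * cr) * cr)⁻¹)
              + 2 * (c₁ * ((((m₀ + oχ * β) + (m₁ + oχ₁ * β₁ + ct * m₀ + oχ₂ * β)) * cr + 1 * (((m₀ + oχ * β) + (m₁ + oχ₁ * β₁ + ct * m₀ + oχ₂ * β)) * cr) * (R * ((β + (β₁ + ct * β)) * (1 - (β + (β₁ + ct * β)) * (R * cr) * cr)⁻¹) * cr) + (β + (β₁ + ct * β)) * o * cr * ((β + (β₁ + ct * β)) * (1 - (β + (β₁ + ct * β)) * (R * cr) * cr)⁻¹) * cr) * (1 - 1 * ((β + (β₁ + ct * β)) * (R * cr) * cr))⁻¹)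
                + o₁ * ((β + (β₁ + ct * β)) * (1 - (β + (β₁ + ct * β)) * (R * cr) * cr)⁻¹))) + rW)
          + (cN * ((((m₀ + oχ * β) + (m₁ + oχ₁ * β₁ + ct * m₀ + oχ₂ * β)) * cr + 1 * (((m₀ + oχ * β) + (m₁ + oχ₁ * β₁ + ct * m₀ + oχ₂ * β)) * cr) * (R * ((β + (β₁ + ct * β)) * (1 - (β + (β₁ + ct * β)) * (R * cr) * cr)⁻¹) * cr) + (β + (β₁ + ct * β)) * o * cr * ((β + (β₁ + ct * β)) * (1 - (β + (β₁ + ct * β)) * (R * cr) * cr)⁻¹) * cr) * (1 - 1 * ((β + (β₁ + ct * β)) * (R * cr) * cr))⁻¹) * cr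
              + rN * ((β + (β₁ + ct * β)) * (1 - (β + (β₁ + ct * β)) * (R * cr) * cr)⁻¹) * cr)
          + ((((ℓ * (Real.exp 1 * ε)⁻¹ + 2 * (ω + ℓ * d₁)) * R)
                * ((((m₀ + oχ * β) + (m₁ + oχ₁ * β₁ + ct * m₀ + oχ₂ * β)) * cr + 1 * (((m₀ + oχ * β) + (m₁ + oχ₁ * β₁ + ct * m₀ + oχ₂ * β)) * cr) * (R * ((β + (β₁ + ct * β)) * (1 - (β + (β₁ + ct * β)) * (R * cr) * cr)⁻¹) * cr) + (β + (β₁ + ct * β)) * o * cr * ((β + (β₁ + ct * β)) * (1 - (β + (β₁ + ct * β)) * (R * cr) * cr)⁻¹) * cr) * (1 - 1 * ((β + (β₁ + ct * β)) * (R * cr) * cr))⁻¹)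
              + ((ℓ * (Real.exp 1 * ε)⁻¹ + 2 * (ω + ℓ * d₁)) * o + 2 * R * (oo + c₁ / n' + c₁ / n))
                * ((β + (β₁ + ct * β)) * (1 - (β + (β₁ + ct * β)) * (R * cr) * cr)⁻¹)
              + R * (c₁ * ((((m₀ + oχ * β) + (m₁ + oχ₁ * β₁ + ct * m₀ + oχ₂ * β)) * cr + 1 * (((m₀ + oχ * β) + (m₁ + oχ₁ * β₁ + ct * m₀ + oχ₂ * β)) * cr) * (R * ((β + (β₁ + ct * β)) * (1 - (β + (β₁ + ct * β)) * (R * cr) * cr)⁻¹) * cr) + (β + (β₁ + ct * β)) * o * cr * ((β + (β₁ + ct * β)) * (1 - (β + (β₁ + ct * β)) * (R * cr) * cr)⁻¹) * cr) * (1 - 1 * ((β + (β₁ + ct * β)) * (R * cr) * cr))⁻¹)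
                + o₁ * ((β + (β₁ + ct * β)) * (1 - (β + (β₁ + ct * β)) * (R * cr) * cr)⁻¹))
              + o * c₁ * ((β + (β₁ + ct * β)) * (1 - (β + (β₁ + ct * β)) * (R * cr) * cr)⁻¹)) * cr))) + ((ε₀ * (1 - (β + (β₁ + ct * β)) * (R * cr) * cr)⁻¹) * oo + (ε₀ * (R * ((((m₀ + oχ * β) + (m₁ + oχ₁ * β₁ + ct * m₀ + oχ₂ * β)) * cr + 1 * (((m₀ + oχ * β) + (m₁ + oχ₁ * β₁ + ct * m₀ + oχ₂ * β)) * cr) * (R * ((β + (β₁ + ct * β)) * (1 - (β + (β₁ + ct * β)) * (R * cr) * cr)⁻¹) * cr) + (β + (β₁ + ct * β)) * o * cr * ((β + (β₁ + ct * β)) * (1 - (β + (β₁ + ct * β)) * (R * cr) * cr)⁻¹) * cr) * (1 - 1 * ((β + (β₁ + ct * β)) * (R * cr) * cr))⁻¹) + o * ((β + (β₁ + ct * β)) * (1 - (β + (β₁ + ct * β)) * (R * cr) * cr)⁻¹)) * cr * cr + rF * (1 + R * ((β + (β₁ + ct * β)) * (1 - (β + (β₁ + ct * β)) * (R * cr)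 * cr)⁻¹) * cr * cr))))) * cr) * cr) * cr +
        Nov * (2 * ((β + (β₁ + ct * β)) * (1 - (β + (β₁ + ct * β)) * (R * cr) * cr)⁻¹) * oo + ((((m₀ + oχ * β) + (m₁ + oχ₁ * β₁ + ct * m₀ + oχ₂ * β)) * cr + 1 * (((m₀ + oχ * β) + (m₁ + oχ₁ * β₁ + ct * m₀ + oχ₂ * β)) * cr) * (R * ((β + (β₁ + ct * β)) * (1 - (β + (β₁ + ct * β)) * (R * cr) * cr)⁻¹) * cr) + (β + (β₁ + ct * β)) * o * cr * ((β + (β₁ + ct * β)) * (1 - (β + (β₁ + ct * β)) * (R * cr) * cr)⁻¹) * cr) * (1 - 1 * ((β + (β₁ + ct * β)) * (R * cr) * cr))⁻¹)) * (1 - Nov * ((((Fintype.card J : ℝ) * (c₂ * ((β + (β₁ + ct * β)) * (1 - (β + (β₁ + ct * β)) * (R * cr) * cr)⁻¹) + 2 * (c₁ * ((β + (β₁ + ct * β)) * (1 - (β + (β₁ + ct * β)) * (R * cr) * cr)⁻¹))) + θW + cN * ((β + (β₁ + ct * β)) * (1 - (β + (β₁ + ct * β)) * (R * cr) * cr)⁻¹)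 * cr)
          + ((ℓ * (Real.exp 1 * ε)⁻¹ + 2 * (ω + ℓ * d₁)) * R * ((β + (β₁ + ct * β)) * (1 - (β + (β₁ + ct * β)) * (R * cr) * cr)⁻¹) * cr + R * c₁ * ((β + (β₁ + ct * β)) * (1 - (β + (β₁ + ct * β)) * (R * cr) * cr)⁻¹) * cr)) + (ε₀ * (1 - (β + (β₁ + ct * β)) * (R * cr) * cr)⁻¹)) * cr)⁻¹ * cr) * Real.exp (-((ρ₃ - 2 * σ) * g.dist y y'))) := by
  obtain ⟨hβb, hmb, hB, hAD, hθ, hε', hrE⟩ := gluedDefect_letters_nonneg (J := J) hβ hβ₁ hct hm₀ hm₁ hoχ hoχ₁ hoχ₂ hR ho hε hc₁ hc₂ hθW hcN hℓ hω hd₁ hε₀ hrF hcr hq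
  have hr : 0 ≤ (((Fintype.card J * (c₂ * ((((m₀ + oχ * β) + (m₁ + oχ₁ * β₁ + ct * m₀ + oχ₂ * β)) * cr + 1 * (((m₀ + oχ * β) + (m₁ + oχ₁ * β₁ + ct * m₀ + oχ₂ * β)) * cr) * (R * ((β + (β₁ + ct * β)) * (1 - (β + (β₁ + ct * β)) * (R * cr) * cr)⁻¹) * cr) + (β + (β₁ + ct * β)) * o * cr * ((β + (β₁ + ct * β)) * (1 - (β + (β₁ + ct * β)) * (R * cr) * cr)⁻¹) * cr) * (1 - 1 * ((β + (β₁ + ct * β)) * (R * cr) * cr))⁻¹)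
              + o₂ * ((β + (β₁ + ct * β)) * (1 - (β + (β₁ + ct * β)) * (R * cr) * cr)⁻¹)
              + 2 * (c₁ * ((((m₀ + oχ * β) + (m₁ + oχ₁ * β₁ + ct * m₀ + oχ₂ * β)) * cr + 1 * (((m₀ + oχ * β) + (m₁ + oχ₁ * β₁ + ct * m₀ + oχ₂ * β)) * cr) * (R * ((β + (β₁ + ct * β)) * (1 - (β + (β₁ + ct * β)) * (R * cr) * cr)⁻¹) * cr) + (β + (β₁ + ct * β)) * o * cr * ((β + (β₁ + ct * β)) * (1 - (β + (β₁ + ct * β)) * (R * cr) * cr)⁻¹) * cr) * (1 - 1 * ((β + (β₁ + ct * β)) * (R * cr) * cr))⁻¹)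
                + o₁ * ((β + (β₁ + ct * β)) * (1 - (β + (β₁ + ct * β)) * (R * cr) * cr)⁻¹))) + rW)
          + (cN * ((((m₀ + oχ * β) + (m₁ + oχ₁ * β₁ + ct * m₀ + oχ₂ * β)) * cr + 1 * (((m₀ + oχ * β) + (m₁ + oχ₁ * β₁ + ct * m₀ + oχ₂ * β)) * cr) * (R * ((β + (β₁ + ct * β)) * (1 - (β + (β₁ + ct * β)) * (R * cr) * cr)⁻¹) * cr) + (β + (β₁ + ct * β)) * o * cr * ((β + (β₁ + ct * β)) * (1 - (β + (β₁ + ct * β)) * (R * cr) * cr)⁻¹) * cr) * (1 - 1 * ((β + (β₁ + ct * β)) * (R * cr) * cr))⁻¹) * cr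
              + rN * ((β + (β₁ + ct * β)) * (1 - (β + (β₁ + ct * β)) * (R * cr) * cr)⁻¹) * cr)
          + ((((ℓ * (Real.exp 1 * ε)⁻¹ + 2 * (ω + ℓ * d₁)) * R)
                * ((((m₀ + oχ * β) + (m₁ + oχ₁ * β₁ + ct * m₀ + oχ₂ * β)) * cr + 1 * (((m₀ + oχ * β) + (m₁ + oχ₁ * β₁ + ct * m₀ + oχ₂ * β)) * cr) * (R * ((β + (β₁ + ct * β)) * (1 - (β + (β₁ + ct * β)) * (R * cr) * cr)⁻¹) * cr) + (β + (β₁ + ct * β)) * o * cr * ((β + (β₁ + ct * β)) * (1 - (β + (β₁ + ct * β)) * (R * cr) * cr)⁻¹) * cr) * (1 - 1 * ((β + (β₁ + ct * β)) * (R * cr) * cr))⁻¹)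
              + ((ℓ * (Real.exp 1 * ε)⁻¹ + 2 * (ω + ℓ * d₁)) * o + 2 * R * (oo + c₁ / n' + c₁ / n))
                * ((β + (β₁ + ct * β)) * (1 - (β + (β₁ + ct * β)) * (R * cr) * cr)⁻¹)
              + R * (c₁ * ((((m₀ + oχ * β) + (m₁ + oχ₁ * β₁ + ct * m₀ + oχ₂ * β)) * cr + 1 * (((m₀ + oχ * β) + (m₁ + oχ₁ * β₁ + ct * m₀ + oχ₂ * β)) * cr) * (R * ((β + (β₁ + ct * β)) * (1 - (β + (β₁ + ct * β)) * (R * cr) * cr)⁻¹) * cr) + (β + (β₁ + ct * β)) * o * cr * ((β + (β₁ + ct * β)) * (1 - (β + (β₁ + ct * β)) * (R * cr) * cr)⁻¹) * cr) * (1 - 1 * ((β + (β₁ + ct * β)) * (R * cr) * cr))⁻¹)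
                + o₁ * ((β + (β₁ + ct * β)) * (1 - (β + (β₁ + ct * β)) * (R * cr) * cr)⁻¹))
              + o * c₁ * ((β + (β₁ + ct * β)) * (1 - (β + (β₁ + ct * β)) * (R * cr) * cr)⁻¹)) * cr))) :=
    add_nonneg (add_nonneg (gluedDefect_r0a_nonneg (J := J) hβ hβ₁ hct hm₀ hm₁ hoχ hoχ₁ hoχ₂ hR ho hc₁ hc₂ ho₁ ho₂ hrW hcr hq)
      (gluedDefect_r0b_nonneg hβ hβ₁ hct hm₀ hm₁ hoχ hoχ₁ hoχ₂ hR ho hcN hrN hcr hq))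
      (gluedDefect_r0c_nonneg n n' hβ hβ₁ hct hm₀ hm₁ hoχ hoχ₁ hoχ₂ hR ho hε hc₁ ho₁ hℓ hω hd₁ hoo hcr hn hn' hq)
  have hσρ₂ : σ ≤ ρ₂ := by linarith only [hσ, hσρ₃, hρ₃₂]
  have hρ₂V : ρ₂ + σ ≤ δV := by linarith only [hρ₂₁, hρ₁V]
  -- files 31∕34∕35: flat letters of both grids' smooth-cut cubes and jets, their defects; file 23: summable Neumann series and the pair letters; file 24: the pair defect
  have hG := fun k => hasMaj_smoothCut_flat blk (S := Sk k) hβ hβ₁ hct (hχt k) (hsub k) (hcut k)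
  have hD := fun k => hasMaj_jet_smoothCut_flat blk τ n (S := Sk k) hβ hβ₁ hct (hχt k) (hdχt k) (hdχtb k) (hs k) (hsb k) (hdd k) (hddb k) (hcut k) (hcutF k) (hcutB k)
  have hG' := fun k => hasMaj_smoothCut_flat (blk ∘ π) (S := Sk k) hβ hβ₁ hct (hχt' k) (hsub' k) (hcut' k)
  have hD' := fun k => hasMaj_jet_smoothCut_flat (blk ∘ π) τ' n' (S := Sk k) hβ hβ₁ hct (hχt' k) (hdχt' k) (hdχtb' k) (hs' k) (hsb' k) (hdd' k) (hddb' k) (hcut' k) (hcutF' k)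
    (hcutB' k)
  have hDG := fun k => hasMaj_idef_smoothCut_flat blk π (S := Sk k) (N := N k) (N' := N' k) hβ hβ₁ hct hm₀ hm₁ hoχ hoχ₁ hoχ₂ (hχt' k) (hfitχ k) (hsub k) (hsub' k) (hcut k) (hDcut k)
  have hDD := fun k => hasMaj_idef_jet_smoothCut_flat blk π τ τ' n n' (S := Sk k) (N := N k) (N' := N' k) hβ hβ₁ hct hm₀ hm₁ hoχ hoχ₁ hoχ₂ (hχt' k) (hdχt' k) (hdχtb' k) (hfit₁ k)
    (hfit₁b k) (hfit₂ k) (hfit₂b k) (hs k) (hsb k) (hdd k) (hddb k) (hs' k) (hsb' k) (hdd' k) (hddb' k) (hcut k) (hcutF k) (hcutB k) (hDcut k) (hDcutF k) (hDcutB k)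
  have hpair := fun k => hasMaj_dressedV_pair blk htri hd hrow hσ hβb hR hcr hσρ hρ₁V hρ₁G hρ₂ hρ₂₁ (hG k) (hD k) hV hq
  have hpair' := fun k => hasMaj_dressedV_pair (blk ∘ π) htri hd hrow hσ hβb hR hcr hσρ hρ₁V hρ₁G hρ₂ hρ₂₁ (hG' k) (hD' k) hV' hq
  have hDX := fun k => hasMaj_idef_dressedV_pair blk π htri hd hrow hσ hcr hβb hR ho hmb hσρ hρ₁V hρ₁G hρ₂ hρ₂₁ (hG k) (hD k) (hG' k) (hD' k) (hDG k) (hDD k) hV hV' hDV hq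
  -- file 34: both grids' cut letters (`M_χX = X`), at the rate `ρ₃`
  have hGc := fun k => by
    have h34 := (hasMaj_smoothCutDressed_loc₂ blk τ n htri hd hrow hσ hβ hβ₁ hct hR hcr hσρ hρ₁V hρ₁G hρ₂ hρ₂₁ (hSχ k) (hSψ k) (hχt k) (hdχt k) (hdχtb k) (hsub k) (hχ k) (hs k) (hsb k) (hdd k) (hddb k) (hNψ k) (hcut k) (hcutF k) (hcutB k) hV hq).mono fun y y' =>
      weight_mul_exp_rate_mono (mul_nonneg (ind_nonneg _ _) (ind_nonneg _ _)) hB hρ₃₂ (hd y y')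
    rw [← mulOp_comp_smoothCutDressed τ n (hχ k) (hNψ k) (hpair k).1] at h34
    exact h34
  have hGc' := fun k => by
    have h34 := (hasMaj_smoothCutDressed_loc₂ (blk ∘ π) τ' n' htri hd hrow hσ hβ hβ₁ hct hR hcr hσρ hρ₁V hρ₁G hρ₂ hρ₂₁ (hSχ' k) (hSψ' k) (hχt' k) (hdχt' k) (hdχtb' k) (hsub' k) (hχ' k) (hs' k) (hsb' k) (hdd' k) (hddb' k) (hNψ' k) (hcut' k) (hcutF' k) (hcutB' k) hV' hq).mono fun y y' =>
      weight_mul_exp_rate_mono (mul_nonneg (ind_nonneg _ _) (ind_nonneg _ _)) hB hρ₃₂ (hd y y')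
    rw [← mulOp_comp_smoothCutDressed τ' n' (hχ' k) (hNψ' k) (hpair' k).1] at h34
    exact h34
  -- file 38: both grids' input-localized remainder rows (rate `ρ₃`)
  have hK := fun k => hasMaj_commOp_cubeOp_smoothCutDressed_in blk τ n htri hd hsymm hrow hσ hβ hβ₁ hct hR hcr hσρ hρ₁V hρ₁G hρ₂ hρ₂₁ hρ₃ hρ₃₂ hρ₃V hρ₃N hε hc₁ hc₂ hθW hcN hℓ hω hd₁ (hSχ k) (hSψ k) (hχt k) (hdχt k) (hdχtb k) (hsub k) (hχ k) (hs k) (hsb k) (hdd k) (hddb k) (hs2 k) (hsb2 k) (hdd2 k) (hddb2 k) (hNψ k) (hcut k) (hcutF k) (hcutB k) hV hq (hh1 k) (hh1b k) (hh2 k) (hLip k) (hrh k) hstep (hW k) (hKN k)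
  have hK' := fun k => hasMaj_commOp_cubeOp_smoothCutDressed_in (blk ∘ π) τ' n' htri hd hsymm hrow hσ hβ hβ₁ hct hR hcr hσρ hρ₁V hρ₁G hρ₂ hρ₂₁ hρ₃ hρ₃₂ hρ₃V hρ₃N hε hc₁ hc₂ hθW hcN hℓ hω hd₁ (hSχ' k) (hSψ' k) (hχt' k) (hdχt' k) (hdχtb' k) (hsub' k) (hχ' k) (hs' k) (hsb' k) (hdd' k) (hddb' k) (hs2' k) (hsb2' k) (hdd2' k) (hddb2' k) (hNψ' k) (hcut' k) (hcutF' k) (hcutB' k) hV' hq (hh1' k) (hh1b' k) (hh2' k) (hLip k) (hrh' k) hstep' (hW' k) (hKN' k)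
  -- file 33: both grids' locality defects' letters (rate `ρ₃`)
  have hE := fun k => (hasMaj_dressedTail_out blk htri hd hrow hσ hβb hR hε₀ hcr hσρ hρ₁V hρ₁G hρ₂ hρ₂₁ hρ₂T (fun _ => rfl) (hG k) (hD k) hV hq (hT k)).mono
    fun y y' => weight_mul_exp_rate_mono (ind_nonneg _ _) hε' hρ₃₂ (hd y y')
  have hE' := fun k => (hasMaj_dressedTail_out (blk ∘ π) htri hd hrow hσ hβb hR hε₀ hcr hσρ hρ₁V hρ₁G hρ₂ hρ₂₁ hρ₂T (fun _ => rfl) (hG' k) (hD' k) hV' hq (hT' k)).mono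
    fun y y' => weight_mul_exp_rate_mono (ind_nonneg _ _) hε' hρ₃₂ (hd y y')
  -- file 35: the two-grid defect of the cut letters (rate `ρ₃`)
  have hDGc := fun k => by
    have h35 := (hasMaj_idef_smoothCutDressed_loc₂ blk π τ τ' n n' htri hd hrow hσ hcr hβ hβ₁ hct hm₀ hm₁ hoχ hoχ₁ hoχ₂ hR ho hσρ hρ₁V hρ₁G hρ₂ hρ₂₁ (hSχ k) (hSψ k) (hSχ' k) (hSψ' k) (hχt k) (hdχt k) (hdχtb k) (hsub k) (hχ k) (hs k) (hsb k) (hdd k) (hddb k) (hNψ k) (hχt' k) (hdχt' k) (hdχtb' k) (hsub' k) (hχ' k) (hs' k) (hsb' k) (hdd' k) (hddb' k) (hNψ' k) (hfitχ k) (hfit₁ k) (hfit₁b k) (hfit₂ k) (hfit₂b k) (hcut k) (hcutF k) (hcutB k) (hcut' k) (hcutF' k) (hcutB' k) (hDcut k) (hDcutF k) (hDcutB k) hV hV' hDV hq).mono fun y y' =>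
      weight_mul_exp_rate_mono (mul_nonneg (ind_nonneg _ _) (ind_nonneg _ _)) hAD hρ₃₂ (hd y y')
    rw [← mulOp_comp_smoothCutDressed τ n (hχ k) (hNψ k) (hpair k).1, ← mulOp_comp_smoothCutDressed τ' n' (hχ' k) (hNψ' k) (hpair' k).1] at h35
    exact h35
  -- file 39: the two-grid defect of the remainder rows (rate `ρ₃`)
  have hDK := fun k => hasMaj_idef_commOp_cubeOp_smoothCutDressed_in blk π τ τ' n n' htri hd hsymm hrow hσ hcr hβ hβ₁ hct hm₀ hm₁ hoχ hoχ₁ hoχ₂ hR ho hσρ hρ₁V hρ₁G hρ₂ hρ₂₁ hρ₃ hρ₃₂ hρ₃V hρ₃N hε hc₁ hc₂ ho₁ ho₂ hrW hcN hrN hℓ hω hd₁ hoo hn hn' (hSχ k) (hSψ k) (hSχ' k) (hSψ' k) (hχt k) (hdχt k) (hdχtb k) (hsub k) (hχ k) (hs k) (hsb k) (hdd k) (hddb k) (hNψ k) (hχt' k) (hdχt' k) (hdχtb' k) (hsub' k) (hχ' k) (hs' k) (hsb' k) (hdd' k) (hddb' k) (hNψ' k) (hfitχ k) (hfit₁ k)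 (hfit₁b k) (hfit₂ k) (hfit₂b k) (hcut k) (hcutF k) (hcutB k) (hcut' k) (hcutF' k) (hcutB' k) (hDcut k) (hDcutF k) (hDcutB k) (hs2 k) (hsb2 k) (hdd2 k) (hddb2 k) (hs2' k) (hsb2' k) (hdd2' k) (hddb2' k) hV hV' hDV hq (hh1 k) (hh1b k) (hh1' k) (hh1b' k) (hh2' k) (hf1 k) (hf1b k) (hf2 k) (hLip k) (hrh k) (hrh' k) (hfh k) hstep hstep' (hDW k) (hKN' k) (hDKN k)
  -- file 33: the two-grid defect of the locality defects (rate `ρ₃`)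
  have hDE := fun k => (hasMaj_idef_dressedTail_out blk π htri hd hrow hσ hcr hR ho hε₀ hrF hB hAD hσρ₂ hρ₂V hρ₂T (fun _ => rfl) (fun _ => rfl) (hpair k).1 (hpair' k).1 (hT' k)
    (hDT k) (hpair k).2 (hDX k) hV hV' hDV).mono fun y y' => weight_mul_exp_rate_mono (ind_nonneg _ _) hrE hρ₃₂ (hd y y')
  exact hasMaj_idef_glued_of_cutRows_defect (liftBlk blk ι) (liftMap π ι) Sk htri hd hd0 hrow hσ hcr hB hθ hε' hAD hr hrE hoo hNov hσρ₃ hhcut hhcut' hhabs hhabs' hfh hN hGc hGc' hK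
    hK' hE hE' hDGc hDK hDE hq'

end Summit.QuantumFields.YangMills.BalabanUVNodes.N15.CurvedSpecies

end
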